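import Summits.CriticalPhenomena.PercolationContinuityZ3.Theses.PercExchangeRateTransport
import Summits.CriticalPhenomena.PercolationContinuityZ3.Theorems.PercExchangeRateTransportCriticalCurveRegularRunBound
import Summits.CriticalPhenomena.PercolationContinuityZ3.Theorems.PercExchangeRateTransportCriticalCurveRegularPlaneMinorant
import Summits.CriticalPhenomena.PercolationContinuityZ3.Theorems.PercExchangeRateTransportCriticalCurveRegularThetaInf
import Summits.CriticalPhenomena.PercolationContinuityZ3.Theorems.PercExchangeRateTransportCriticalCurveRegularBoxLaw
import Summits.CriticalPhenomena.PercolationContinuityZ3.Theorems.PercExchangeRateTransportCriticalCurveRegularTwoClassShear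
import Summits.CriticalPhenomena.PercolationContinuityZ3.Theorems.PercExchangeRateTransportCriticalCurveRegularLocModScheme
import Summits.CriticalPhenomena.PercolationContinuityZ3.Theorems.PercExchangeRateTransportCriticalCurveRegularLocModBoxBonds
import Summits.CriticalPhenomena.PercolationContinuityZ3.Theorems.PercExchangeRateTransportCriticalCurveRegularCore

/-!
# `CriticalCurveRegular` of route PercExchangeRateTransport (item stmt-CriticalPhenomena-16065) — PROVED

The crux: for the label-coupled anisotropic bond family on `ℤ²×ℤ` (`μ = labelMeasure (Site 3)`, an
`x`/`y`-bond open iff `U_e ≤ p`, a `z`-bond iff `U_e ≤ t`), `θ(p,t) = μ{0 percolates}`,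
`p_c(t) = sInf ({p ∈ [0,1] | θ(p,t) > 0} ∪ {1})`:  `ContinuousOn p_c (0,1) ∧ ∀ t ∈ (0,1), 0 < p_c(t) < 1`.

Line `locmod` (Cruxes/CriticalCurveRegular/Lines/locmod.lean, planner-cstrat-stmt-CriticalPhenomena-16065-b1-0;
lead prover-line-stmt-CriticalPhenomena-16065-0): the ONE-SIDED Aizenman–Grimmett shear
`∂_tΘ_n ≤ C ∂_pΘ_n` ⟹ `θ(p,t) ≤ θ(p + C(t−s), s)` on compact rectangles of `(0,1)²` ⟹ `p_c` locally
Lipschitz, plus `p_c(t) ≥ (1−t)/8` (run counting) and `p_c(t) ≤ (p_c(ℤ²)+1)/2` (planar minorant). The six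
registered stubs are the landed theorems

* `stub_runBound` (`…CriticalCurveRegularRunBound`), `stub_planeMinorant` (`…PlaneMinorant`),
  `stub_thetaInf` (`…ThetaInf`), `stub_boxLaw` (`…BoxLaw`), `stub_twoClassShear` (`…TwoClassShear`),
  and `stub_locModScheme`, proved IN THIS FILE (windows `Cw e = edgesTouching (Icc (x-2) (x+2))`,
  `N = 750`, overlap counting) from the isolation scheme `Scheme.isolation_scheme` of
  `…LocModScheme` (with `…LocModClusters/BoxPaths/Isolation/BoxBonds`: the isolation surgery of the
  crux idea `isolation-descent` — close the window, keep the entry/exit bonds, open one column — and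
  the descent to one pivotal horizontal bond; Grimmett 1999 §3.3 (3.12) for this family),

and the percolation-free core `curve_regular_core` (`…CriticalCurveRegularCore`). The rest is the glue
of the skeleton written out over the explicit expressions (no local definitions): the finite-volume
shear of the polynomial for every `n`, the shear of `θ = ⨅ Θ_n`, monotonicity of `θ`, the shape
consumed by the core, and `CriticalCurveRegular_proof` concluding the route decl BY NAME.
Sorry-free; axioms `propext`, `Classical.choice`, `Quot.sound`.
-/

noncomputable section

open MeasureTheory Set
open Literature.Probability.Percolation Literature.Probability.LatticeModels

namespace Summit.CriticalPhenomena.PercolationContinuityZ3.Cruxes.CriticalCurveRegular.Locmod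

/-! ## Stub 6: windows, overlaps and the registered `stub_locModScheme` -/

namespace LocModStub

/-! ## The windows and their overlaps -/

/-- The window of a vertical bond has at most `750` bonds. -/
theorem card_window_le (x : Site 3) :
    (edgesTouching (zdGraph 3) (Finset.Icc (x - 2) (x + 2))).card ≤ 750 :=
  (BoxPaths.card_edgesTouching_le _).trans (by rw [BoxPaths.card_Icc_two])

/-- If a bond `f` touches the window of `x`, then `x` lies in the window of an endpoint of `f`. -/
theorem exists_mem_Icc_of_mem_window {x : Site 3} {f : Sym2 (Site 3)}
    (hf : f ∈ edgesTouching (zdGraph 3) (Finset.Icc (x - 2) (x + 2))) :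
    ∃ u ∈ f, x ∈ Finset.Icc (u - 2) (u + 2) := by
  rw [mem_edgesTouching_iff] at hf
  obtain ⟨-, u, hu, huf⟩ := hf
  refine ⟨u, huf, ?_⟩
  rw [BoxPaths.mem_Icc_two_iff] at hu ⊢
  intro i
  have := hu i
  constructor <;> omega

/-- **Overlap bound.** For a fixed bond `f = {u₁, u₂}`, at most `750` vertical bonds `e = {x, x+e₃}`
(from any finite family of them) have `f` in their window. -/
theorem card_filter_window_le (u₁ u₂ : Site 3) (V : Finset (Site 3))
    (Cw : Sym2 (Site 3) → Finset (Sym2 (Site 3)))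
    (hCw : ∀ x ∈ V, Cw s(x, x + Pi.single (2 : Fin 3) 1) =
      edgesTouching (zdGraph 3) (Finset.Icc (x - 2) (x + 2))) :
    ((V.image fun x => s(x, x + Pi.single (2 : Fin 3) 1)).filter
        fun e => s(u₁, u₂) ∈ Cw e).card ≤ 750 := by
  classical
  have hsub : ((V.image fun x => s(x, x + Pi.single (2 : Fin 3) 1)).filter
      fun e => s(u₁, u₂) ∈ Cw e) ⊆
      (Finset.Icc (u₁ - 2) (u₁ + 2) ∪ Finset.Icc (u₂ - 2) (u₂ + 2)).image
        fun x => s(x, x + Pi.single (2 : Fin 3) 1) := by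
    intro e he
    rw [Finset.mem_filter] at he
    obtain ⟨he, hf⟩ := he
    obtain ⟨x, hxV, rfl⟩ := Finset.mem_image.1 he
    rw [hCw x hxV] at hf
    obtain ⟨u, huf, hxu⟩ := exists_mem_Icc_of_mem_window hf
    refine Finset.mem_image.2 ⟨x, ?_, rfl⟩
    rw [Finset.mem_union]
    rcases Sym2.mem_iff.1 huf with rfl | rfl
    · exact Or.inl hxu
    · exact Or.inr hxu
  calc ((V.image fun x => s(x, x + Pi.single (2 : Fin 3) 1)).filter
          fun e => s(u₁, u₂) ∈ Cw e).card
      ≤ ((Finset.Icc (u₁ - 2) (u₁ + 2) ∪ Finset.Icc (u₂ - 2) (u₂ + 2)).image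
          fun x => s(x, x + Pi.single (2 : Fin 3) 1)).card := Finset.card_le_card hsub
    _ ≤ (Finset.Icc (u₁ - 2) (u₁ + 2) ∪ Finset.Icc (u₂ - 2) (u₂ + 2)).card := Finset.card_image_le
    _ ≤ (Finset.Icc (u₁ - 2) (u₁ + 2)).card + (Finset.Icc (u₂ - 2) (u₂ + 2)).card :=
        Finset.card_union_le _ _
    _ ≤ 750 := by rw [BoxPaths.card_Icc_two, BoxPaths.card_Icc_two]; norm_num

end LocModStub

open LocModStub in
/-- **stub 6 (registered) = `Stubs.stub_locModScheme` — the deterministic local modification for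
`{0 ↔ ∂Λ_n}` on `Λ_n ⊂ ℤ²×ℤ`, uniformly in `n` (`N = 750`).** The window of `e = {x, x+e₃}` is the
set of lattice bonds touching the cube `x + {-2..2}³`; the modification is the isolation scheme
`Scheme.isolation_scheme` (close the window, keep the entry/exit bonds, open one column, then descend
to a single pivotal horizontal bond). -/
theorem stub_locModScheme :
    ∃ N : ℕ, ∀ n : ℕ, ∃ Cw : Sym2 (Site 3) → Finset (Sym2 (Site 3)),
      (∀ e ∈ (((box 3 n).filter fun x => x + Pi.single (2 : Fin 3) 1 ∈ box 3 n).image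
          fun x => s(x, x + Pi.single (2 : Fin 3) 1)), (Cw e).card ≤ N) ∧
      (∀ f ∈ ((((box 3 n).filter fun x => x + Pi.single (0 : Fin 3) 1 ∈ box 3 n).image
            fun x => s(x, x + Pi.single (0 : Fin 3) 1)) ∪
            (((box 3 n).filter fun x => x + Pi.single (1 : Fin 3) 1 ∈ box 3 n).image
            fun x => s(x, x + Pi.single (1 : Fin 3) 1))),
        ((((box 3 n).filter fun x => x + Pi.single (2 : Fin 3) 1 ∈ box 3 n).image
          fun x => s(x, x + Pi.single (2 : Fin 3) 1)).filter fun e => f ∈ Cw e).card ≤ N) ∧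
      (∀ e ∈ (((box 3 n).filter fun x => x + Pi.single (2 : Fin 3) 1 ∈ box 3 n).image
          fun x => s(x, x + Pi.single (2 : Fin 3) 1)),
        ∀ S : Finset (Sym2 (Site 3)),
          S ⊆ (((box 3 n).filter fun x => x + Pi.single (2 : Fin 3) 1 ∈ box 3 n).image
                fun x => s(x, x + Pi.single (2 : Fin 3) 1)) ∪
              ((((box 3 n).filter fun x => x + Pi.single (0 : Fin 3) 1 ∈ box 3 n).image
                fun x => s(x, x + Pi.single (0 : Fin 3) 1)) ∪
              (((box 3 n).filter fun x => x + Pi.single (1 : Fin 3) 1 ∈ box 3 n).image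
                fun x => s(x, x + Pi.single (1 : Fin 3) 1))) →
          IsPivotal (siteToBoundary 3 n) e (↑S : Set (Sym2 (Site 3))) →
          ∃ S' : Finset (Sym2 (Site 3)),
            S' ⊆ (((box 3 n).filter fun x => x + Pi.single (2 : Fin 3) 1 ∈ box 3 n).image
                  fun x => s(x, x + Pi.single (2 : Fin 3) 1)) ∪
                ((((box 3 n).filter fun x => x + Pi.single (0 : Fin 3) 1 ∈ box 3 n).image
                  fun x => s(x, x + Pi.single (0 : Fin 3) 1)) ∪
                (((box 3 n).filter fun x => x + Pi.single (1 : Fin 3) 1 ∈ box 3 n).image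
                  fun x => s(x, x + Pi.single (1 : Fin 3) 1))) ∧
            (∃ f ∈ ((((box 3 n).filter fun x => x + Pi.single (0 : Fin 3) 1 ∈ box 3 n).image
                  fun x => s(x, x + Pi.single (0 : Fin 3) 1)) ∪
                  (((box 3 n).filter fun x => x + Pi.single (1 : Fin 3) 1 ∈ box 3 n).image
                  fun x => s(x, x + Pi.single (1 : Fin 3) 1))),
                f ∈ Cw e ∧ IsPivotal (siteToBoundary 3 n) f (↑S' : Set (Sym2 (Site 3)))) ∧
            ∀ i, i ∉ Cw e → (i ∈ S ↔ i ∈ S')) := by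
  classical
  -- the window map: the bonds touching the cube of radius `2` about the lower endpoint
  set Cw : Sym2 (Site 3) → Finset (Sym2 (Site 3)) := fun e =>
    if h : ∃ x : Site 3, e = s(x, x + Pi.single (2 : Fin 3) 1) then
      edgesTouching (zdGraph 3) (Finset.Icc (h.choose - 2) (h.choose + 2)) else ∅ with hCwdef
  have hCw : ∀ x : Site 3, Cw s(x, x + Pi.single (2 : Fin 3) 1) =
      edgesTouching (zdGraph 3) (Finset.Icc (x - 2) (x + 2)) := by
    intro x
    have h : ∃ x' : Site 3, s(x, x + Pi.single (2 : Fin 3) 1) = s(x', x' + Pi.single (2 : Fin 3) 1) :=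
      ⟨x, rfl⟩
    simp only [hCwdef, dif_pos h]
    rw [← BoxPaths.eq_of_mk_vert_eq h.choose_spec]
  refine ⟨750, fun n => ⟨Cw, ?_, ?_, ?_⟩⟩
  · -- window size
    intro e he
    obtain ⟨x, -, rfl⟩ := Finset.mem_image.1 he
    rw [hCw x]
    exact card_window_le x
  · -- overlaps
    intro f hf
    obtain ⟨hfE, -⟩ := BoxBonds.edge_of_mem_KV_KH (Finset.mem_union_right _ hf)
    induction f using Sym2.ind with
    | h u₁ u₂ => exact card_filter_window_le u₁ u₂ _ Cw fun x _ => hCw x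
  · -- the modification
    intro e he S hS hpiv
    obtain ⟨x, hx, rfl⟩ := Finset.mem_image.1 he
    rw [Finset.mem_filter] at hx
    obtain ⟨hx, hx3⟩ := hx
    have hn : 1 ≤ n := by
      by_contra h0
      push Not at h0
      have hn0 : n = 0 := by omega
      subst hn0
      rw [mem_box] at hx hx3
      have h1 := (hx 2).1
      have h2 := (hx3 2).2
      simp at h1 h2
      omega
    have hSE : ∀ g ∈ S, g ∈ (zdGraph 3).edgeSet := fun g hg => (BoxBonds.edge_of_mem_KV_KH (hS hg)).1
    obtain ⟨S'', hS''sub, ⟨f, hfW, ⟨y, i, hi, rfl, hy, hyi⟩, hfpiv⟩, hagree⟩ :=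
      Scheme.isolation_scheme hn hx hSE hpiv
    refine ⟨S'', fun g hg => ?_, ⟨s(y, y + Pi.single i 1), BoxBonds.mem_KH_of_horiz hi hy hyi, ?_, hfpiv⟩, ?_⟩
    · rcases hS''sub g hg with hgS | ⟨hgW, hgΛ⟩
      · exact hS hgS
      · exact BoxBonds.mem_KV_or_KH_of_edge (mem_edgesTouching_iff.1 hgW).1 hgΛ
    · rw [hCw x]; exact hfW
    · intro i hi
      rw [hCw x] at hi
      exact hagree i hi

/-! ## Glue, steps (ii)–(iii): the shear of `Θ_n` for every `n`, and of `θ = ⨅ Θ_n` -/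

/-- **The infinite-volume shear of `θ`** (stubs 3–6): with `N` from the local-modification scheme and
`C = μ₀^{-N} 2^N N`, `θ(p,t) ≤ θ(p + C h, t − h)` as long as all parameters stay in `[μ₀, 1 − μ₀]`. -/
theorem theta_shear :
    ∃ N : ℕ, ∀ μ₀ : ℝ, 0 < μ₀ → μ₀ ≤ 1 / 2 → ∀ (p t h : ℝ), 0 ≤ h → μ₀ ≤ p →
      p + (μ₀ ^ N)⁻¹ * 2 ^ N * (N : ℝ) * h ≤ 1 - μ₀ → μ₀ ≤ t - h → t ≤ 1 - μ₀ →
      (labelMeasure (Site 3)).real {U |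
        {e | e ∈ (zdGraph 3).edgeSet ∧
            (((∃ x : Site 3, e = s(x, x + Pi.single (2 : Fin 3) 1)) ∧ U e ≤ t) ∨
              (¬ (∃ x : Site 3, e = s(x, x + Pi.single (2 : Fin 3) 1)) ∧ U e ≤ p))} ∈
          percolatesAt (0 : Site 3)} ≤
      (labelMeasure (Site 3)).real {U |
        {e | e ∈ (zdGraph 3).edgeSet ∧
            (((∃ x : Site 3, e = s(x, x + Pi.single (2 : Fin 3) 1)) ∧ U e ≤ t - h) ∨
              (¬ (∃ x : Site 3, e = s(x, x + Pi.single (2 : Fin 3) 1)) ∧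
                U e ≤ p + (μ₀ ^ N)⁻¹ * 2 ^ N * (N : ℝ) * h))} ∈
          percolatesAt (0 : Site 3)} := by
  classical
  obtain ⟨N, hN⟩ := stub_locModScheme
  refine ⟨N, fun μ₀ hμ₀ hμ₁ p t h hh hp hp' ht ht' => ?_⟩
  -- the finite-volume shear of the polynomial, for every `n` (stub 5 fed with stub 6)
  have hfin : ∀ n : ℕ,
      ProdWeight.gTheta ((box 3 n).sym2) (siteToBoundary 3 n) (fun e =>
        if e ∈ (((box 3 n).filter fun x => x + Pi.single (2 : Fin 3) 1 ∈ box 3 n).image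
            fun x => s(x, x + Pi.single (2 : Fin 3) 1)) then t
        else if e ∈ ((((box 3 n).filter fun x => x + Pi.single (0 : Fin 3) 1 ∈ box 3 n).image
            fun x => s(x, x + Pi.single (0 : Fin 3) 1)) ∪
            (((box 3 n).filter fun x => x + Pi.single (1 : Fin 3) 1 ∈ box 3 n).image
            fun x => s(x, x + Pi.single (1 : Fin 3) 1))) then p
        else 0) ≤
      ProdWeight.gTheta ((box 3 n).sym2) (siteToBoundary 3 n) (fun e =>
        if e ∈ (((box 3 n).filter fun x => x + Pi.single (2 : Fin 3) 1 ∈ box 3 n).image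
            fun x => s(x, x + Pi.single (2 : Fin 3) 1)) then t - h
        else if e ∈ ((((box 3 n).filter fun x => x + Pi.single (0 : Fin 3) 1 ∈ box 3 n).image
            fun x => s(x, x + Pi.single (0 : Fin 3) 1)) ∪
            (((box 3 n).filter fun x => x + Pi.single (1 : Fin 3) 1 ∈ box 3 n).image
            fun x => s(x, x + Pi.single (1 : Fin 3) 1))) then p + (μ₀ ^ N)⁻¹ * 2 ^ N * (N : ℝ) * h
        else 0) := by
    intro n
    obtain ⟨Cw, hcard, hover, hmod⟩ := hN n
    exact stub_twoClassShear (Sym2 (Site 3)) ((box 3 n).sym2) _ _ (siteToBoundary 3 n) Cw N μ₀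
      (DCT16.isUpperSet_siteToBoundary 3 n) (BoxBonds.KV_subset_sym2 n) (BoxBonds.KH_subset_sym2 n) (BoxBonds.disjoint_KV_KH n)
      hcard hover hmod hμ₀ hμ₁ p t h hh hp hp' ht ht'
  -- pass to `θ = ⨅ Θ_n` (stub 3) through the law (stub 4)
  have hC0 : 0 ≤ (μ₀ ^ N)⁻¹ * 2 ^ N * (N : ℝ) :=
    mul_nonneg (mul_nonneg (inv_nonneg.2 (pow_nonneg hμ₀.le _)) (by positivity)) (Nat.cast_nonneg _)
  have hCh : 0 ≤ (μ₀ ^ N)⁻¹ * 2 ^ N * (N : ℝ) * h := mul_nonneg hC0 hh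
  rw [stub_thetaInf p t, stub_thetaInf (p + (μ₀ ^ N)⁻¹ * 2 ^ N * (N : ℝ) * h) (t - h)]
  refine le_ciInf fun n => (ciInf_le ⟨0, ?_⟩ n).trans ?_
  · rintro _ ⟨m, rfl⟩; exact measureReal_nonneg
  · rw [stub_boxLaw n p t (by linarith) (by linarith) (by linarith) (by linarith),
      stub_boxLaw n _ _ (by linarith) (by linarith) (by linarith) (by linarith)]
    exact hfin n

/-! ## Glue, step (iv): monotonicity of `θ` in `(p, t)` (pathwise coupling) -/

/-- `θ(p,t)` is nondecreasing in both parameters (the configurations are nested pathwise). -/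
theorem theta_mono {p p' t t' : ℝ} (hp : p ≤ p') (ht : t ≤ t') :
    (labelMeasure (Site 3)).real {U |
        {e | e ∈ (zdGraph 3).edgeSet ∧
            (((∃ x : Site 3, e = s(x, x + Pi.single (2 : Fin 3) 1)) ∧ U e ≤ t) ∨
              (¬ (∃ x : Site 3, e = s(x, x + Pi.single (2 : Fin 3) 1)) ∧ U e ≤ p))} ∈
          percolatesAt (0 : Site 3)} ≤
      (labelMeasure (Site 3)).real {U |
        {e | e ∈ (zdGraph 3).edgeSet ∧
            (((∃ x : Site 3, e = s(x, x + Pi.single (2 : Fin 3) 1)) ∧ U e ≤ t') ∨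
              (¬ (∃ x : Site 3, e = s(x, x + Pi.single (2 : Fin 3) 1)) ∧ U e ≤ p'))} ∈
          percolatesAt (0 : Site 3)} := by
  have := isProbabilityMeasure_labelMeasure (Site 3)
  refine measureReal_mono fun U hU => percolatesAt_mono ?_ 0 hU
  rintro e ⟨he, h | h⟩
  · exact ⟨he, Or.inl ⟨h.1, h.2.trans ht⟩⟩
  · exact ⟨he, Or.inr ⟨h.1, h.2.trans hp⟩⟩

/-! ## Glue, step (v): the shear in the shape consumed by the real-variable core -/

/-- **Shear monotonicity on compact rectangles of the open square.** For `[lo,hi] × [plo,phi] ⊂ (0,1)²`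
there is `C ≥ 0` with `θ(p,t) ≤ θ(p + C|t−s|, s)` whenever `s,t ∈ [lo,hi]`, `plo ≤ p` and
`p + C|t−s| ≤ phi`. -/
theorem shear_birth_shape :
    ∀ lo hi plo phi : ℝ, 0 < lo → lo ≤ hi → hi < 1 → 0 < plo → plo ≤ phi → phi < 1 →
      ∃ C : ℝ, 0 ≤ C ∧ ∀ s ∈ Set.Icc lo hi, ∀ t ∈ Set.Icc lo hi, ∀ p : ℝ, plo ≤ p →
        p + C * |t - s| ≤ phi →
        (labelMeasure (Site 3)).real {U |
          {e | e ∈ (zdGraph 3).edgeSet ∧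
              (((∃ x : Site 3, e = s(x, x + Pi.single (2 : Fin 3) 1)) ∧ U e ≤ t) ∨
                (¬ (∃ x : Site 3, e = s(x, x + Pi.single (2 : Fin 3) 1)) ∧ U e ≤ p))} ∈
            percolatesAt (0 : Site 3)} ≤
        (labelMeasure (Site 3)).real {U |
          {e | e ∈ (zdGraph 3).edgeSet ∧
              (((∃ x : Site 3, e = s(x, x + Pi.single (2 : Fin 3) 1)) ∧ U e ≤ s) ∨
                (¬ (∃ x : Site 3, e = s(x, x + Pi.single (2 : Fin 3) 1)) ∧ U e ≤ p + C * |t - s|))} ∈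
            percolatesAt (0 : Site 3)} := by
  obtain ⟨N, hN⟩ := theta_shear
  intro lo hi plo phi hlo hlohi hhi hplo hplophi hphi
  set μ₀ : ℝ := min (1 / 2) (min (min lo (1 - hi)) (min plo (1 - phi))) with hμ₀def
  have hμ₀pos : 0 < μ₀ :=
    lt_min (by norm_num) (lt_min (lt_min hlo (by linarith)) (lt_min hplo (by linarith)))
  have hμ₀half : μ₀ ≤ 1 / 2 := min_le_left _ _
  have hrest : μ₀ ≤ min (min lo (1 - hi)) (min plo (1 - phi)) := min_le_right _ _
  have hμlo : μ₀ ≤ lo := hrest.trans ((min_le_left _ _).trans (min_le_left _ _))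
  have hμhi : μ₀ ≤ 1 - hi := hrest.trans ((min_le_left _ _).trans (min_le_right _ _))
  have hμplo : μ₀ ≤ plo := hrest.trans ((min_le_right _ _).trans (min_le_left _ _))
  have hμphi : μ₀ ≤ 1 - phi := hrest.trans ((min_le_right _ _).trans (min_le_right _ _))
  have hC0 : 0 ≤ (μ₀ ^ N)⁻¹ * 2 ^ N * (N : ℝ) :=
    mul_nonneg (mul_nonneg (inv_nonneg.2 (pow_nonneg hμ₀pos.le _)) (by positivity)) (Nat.cast_nonneg _)
  refine ⟨(μ₀ ^ N)⁻¹ * 2 ^ N * (N : ℝ), hC0, fun s hs t ht p hp hfit => ?_⟩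
  rcases le_or_gt s t with hst | hst
  · have habs : |t - s| = t - s := abs_of_nonneg (by linarith)
    rw [habs] at hfit ⊢
    have key := hN μ₀ hμ₀pos hμ₀half p t (t - s) (by linarith) (by linarith) (by linarith)
      (by linarith [hs.1]) (by linarith [ht.2])
    have e : t - (t - s) = s := by ring
    rw [e] at key
    exact key
  · exact theta_mono (le_add_of_nonneg_right (mul_nonneg hC0 (abs_nonneg _))) hst.le

/-! ## The crux, by name -/

/-- **`CriticalCurveRegular` (route PercExchangeRateTransport, item stmt-CriticalPhenomena-16065), proved.**
The anisotropic critical curve `t ↦ p_c(t)` of bond percolation on `ℤ²×ℤ` is continuous on `(0,1)`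
with `0 < p_c(t) < 1`: the percolation-free core `curve_regular_core` fed with the run bound
(`stub_runBound`), the planar minorant at `q₀ = (p_c(ℤ²)+1)/2` (`stub_planeMinorant` and the tree's
`0 < p_c(ℤ²) < 1`, `θ_{ℤ²} > 0` above `p_c`), and the one-sided Aizenman–Grimmett shear
(`shear_birth_shape`). -/
theorem CriticalCurveRegular_proof :
    Summit.CriticalPhenomena.PercolationContinuityZ3.Theses.PercExchangeRateTransport.CriticalCurveRegular := by
  have h2b := Grimmett1999_criticalProb_pos_lt_one_holds 2 (by norm_num)
  have hq0 : (0 : ℝ) ≤ (criticalProb (zdGraph 2) (0 : Site 2) + 1) / 2 := by linarith [h2b.1]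
  have hq1 : (criticalProb (zdGraph 2) (0 : Site 2) + 1) / 2 < 1 := by linarith [h2b.2]
  have hq01 : (criticalProb (zdGraph 2) (0 : Site 2) + 1) / 2 ≤ 1 := hq1.le
  have hθ₂ : 0 < theta (zdGraph 2) 0 ⟨(criticalProb (zdGraph 2) (0 : Site 2) + 1) / 2, hq0, hq01⟩ :=
    theta_pos_of_criticalProb_lt_holds _ _ _ (by
      show criticalProb (zdGraph 2) 0 < (criticalProb (zdGraph 2) (0 : Site 2) + 1) / 2
      linarith [h2b.2])
  exact curve_regular_core
    (θ := fun p t => (labelMeasure (Site 3)).real {U |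
      {e | e ∈ (zdGraph 3).edgeSet ∧
          (((∃ x : Site 3, e = s(x, x + Pi.single (2 : Fin 3) 1)) ∧ U e ≤ t) ∨
            (¬ (∃ x : Site 3, e = s(x, x + Pi.single (2 : Fin 3) 1)) ∧ U e ≤ p))} ∈
        percolatesAt (0 : Site 3)})
    (fun _ => rfl) stub_runBound hq0 hq1 (fun t => hθ₂.trans_le (stub_planeMinorant _ t))
    shear_birth_shape

end Summit.CriticalPhenomena.PercolationContinuityZ3.Cruxes.CriticalCurveRegular.Locmod

end
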